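import Mathlib
import HarnessLib
import Summits.HubbardSuperconductivity.HubbardSuperconductivity.Theorems.KLProgrammeKLRegimeEngineV8Defs
import Summits.HubbardSuperconductivity.HubbardSuperconductivity.Theorems.KLProgrammeKLRegimeSplitThermalLayerExt

/-!
# Route `KLProgramme` — the engine's volume threshold against the infrared scales: `klEngL₃ β U ≤ L ⇒ 2⁸·π·β/U² ≤ L·Λ_n` on the whole ladder

Cell `gate-hubbard-kl`, seat hubbard-kl-k3c3-p3 (g7); plan g19 (R56) (KL STATUS l.3359) for c4a-1's F3/Poisson alias hypothesis
`hLΛ : X ≤ (L:ℝ) * klScale klE0 n` of the LAYER-2 representation (engine-flow child `KLRegimeEngineV17F2`, stmt-HubbardSuperconductivity-20437,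
stub (C)).  The pen's arithmetic, as a lemma: `klEngL₃ β U = 2^{10}(⌈|β|⌉₊+1)²(⌈|U|⁻¹⌉₊+1)² ≥ 2^{10}β²/U²` (`sq_div_sq_le_klEngL₃`) and
`π/β ≤ 4Λ_n` for `n ≤ n_β + 1` (`klte_pi_div_le_four_mul_klScale`, …ThermalLayerExt) give
**`le_L_mul_klScale_of_klEngL₃_le`**: `klEngL₃ β U ≤ L → klBetaMin ≤ β → 0 < U → n ≤ nScales β + 1 → 2^8·π·β/U² ≤ L·klScale klE0 n` —
the lattice is finer than every infrared cutoff the skeleton visits by a factor `≥ 2^8πβ/U²`.  Everything is PROVED; no definitions.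
-/

noncomputable section

namespace Summit.HubbardSuperconductivity.HubbardSuperconductivity.Theorems.KLRegimeSplit

set_option linter.dupNamespace false -- summit = problem name (single-conjunct summit), D-0017

open Real Summit.HubbardSuperconductivity.HubbardSuperconductivity.Theorems.EngineV8
open Summit.HubbardSuperconductivity.HubbardSuperconductivity.Theorems.KLProgrammeLegKernels

/-- **`2^{10}·β²/U² ≤ klEngL₃ β U`** for `U ≠ 0` (`(⌈|β|⌉₊+1)² ≥ β²`, `(⌈|U|⁻¹⌉₊+1)² ≥ U⁻²`). -/
theorem sq_div_sq_le_klEngL₃ {β U : ℝ} (hU : 0 < U) : 2 ^ 10 * β ^ 2 / U ^ 2 ≤ (klEngL₃ β U : ℝ) := by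
  unfold klEngL₃
  push_cast
  have hb : |β| ≤ (⌈|β|⌉₊ : ℝ) := Nat.le_ceil _
  have hu : |U|⁻¹ ≤ (⌈|U|⁻¹⌉₊ : ℝ) := Nat.le_ceil _
  have hb0 : (0 : ℝ) ≤ ⌈|β|⌉₊ := Nat.cast_nonneg _
  have hu0 : (0 : ℝ) ≤ ⌈|U|⁻¹⌉₊ := Nat.cast_nonneg _
  have h1 : β ^ 2 ≤ ((⌈|β|⌉₊ : ℝ) + 1) ^ 2 := by
    rw [← sq_abs β]; nlinarith [abs_nonneg β]
  have h2 : 1 / U ^ 2 ≤ ((⌈|U|⁻¹⌉₊ : ℝ) + 1) ^ 2 := by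
    have hinv : 1 / U ^ 2 = (|U|⁻¹) ^ 2 := by rw [inv_pow, sq_abs, one_div]
    rw [hinv]; nlinarith [inv_nonneg.2 (abs_nonneg U)]
  have h3 : 2 ^ 10 * β ^ 2 / U ^ 2 = 2 ^ 10 * β ^ 2 * (1 / U ^ 2) := by ring
  rw [h3]
  have hβ2 : 0 ≤ β ^ 2 := sq_nonneg β
  calc (2 : ℝ) ^ 10 * β ^ 2 * (1 / U ^ 2) ≤ 2 ^ 10 * ((⌈|β|⌉₊ : ℝ) + 1) ^ 2 * (((⌈|U|⁻¹⌉₊ : ℝ) + 1) ^ 2) :=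
        mul_le_mul (mul_le_mul_of_nonneg_left h1 (by positivity)) h2 (by positivity) (by positivity)
    _ = _ := by ring

/-- **The volume threshold dominates every infrared scale of the ladder**: `klEngL₃ β U ≤ L`, `klBetaMin ≤ β`, `0 < U`, `n ≤ nScales β + 1`
⟹ `2^8·π·β/U² ≤ L · klScale klE0 n` (plan g19 (R56); with `klEngL₄` use `klEngL₃_le_of_klEngL₄_le` first). -/
theorem le_L_mul_klScale_of_klEngL₃_le {β U : ℝ} {L n : ℕ} (hL : klEngL₃ β U ≤ L) (hβ : klBetaMin ≤ β) (hU : 0 < U)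
    (hn : n ≤ nScales β + 1) : 2 ^ 8 * Real.pi * β / U ^ 2 ≤ (L : ℝ) * klScale klE0 n := by
  have hβ0 : 0 < β := pos_of_klBetaMin_le hβ
  have hLr : 2 ^ 10 * β ^ 2 / U ^ 2 ≤ (L : ℝ) := (sq_div_sq_le_klEngL₃ (β := β) hU).trans (by exact_mod_cast hL)
  have hsc : Real.pi / β ≤ 4 * klScale klE0 n := klte_pi_div_le_four_mul_klScale hβ hn
  have hsc' : Real.pi / (4 * β) ≤ klScale klE0 n := by
    rw [div_le_iff₀ (by positivity)]; rw [div_le_iff₀ hβ0] at hsc; linarith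
  have hpos : 0 ≤ 2 ^ 10 * β ^ 2 / U ^ 2 := by positivity
  calc 2 ^ 8 * Real.pi * β / U ^ 2 = (2 ^ 10 * β ^ 2 / U ^ 2) * (Real.pi / (4 * β)) := by field_simp; ring
    _ ≤ (L : ℝ) * klScale klE0 n := mul_le_mul hLr hsc' (by positivity) (Nat.cast_nonneg _)

end Summit.HubbardSuperconductivity.HubbardSuperconductivity.Theorems.KLRegimeSplit

end
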